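import Literature.InformationTheory.QuantumCodes.SyndromeDecoding
import Literature.InformationTheory.QuantumCodes.CodeCapacityNoise
import Mathlib.Probability.ProbabilityMassFunction.Basic
import Mathlib.Topology.Instances.ENNReal.Lemmas
import HarnessLib

/-!
# The logical failure probability of a decoder under a stochastic error model, and the
# threshold of a (code family, decoder family, noise model) triple

Topic `Literature/InformationTheory/QuantumCodes` (venture QEC, LADDER-QEC Q5, PARTITION row 09:
"`logicalFailureProb (family k) (decoder k) (p)`", "`HasThreshold family decoder pth :↔ ∀ p < pth,
logicalFailureProb → 0`"; v2 D2.1: Literature-side). Column word DEFINITION; the two lemmas are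
routine (PROVED). This is the vocabulary glue between the tree's abstract decoder layer
(`SyndromeDecoding.lean`: `Decoder Syn Err`, `D.Corrects syn S e :↔ D (syn e) + e ∈ S`) and a
stochastic error model given as a Mathlib `PMF` on the errors (e.g. `iidPauliNoise (depolarizingLaw
p hp) ι` of `PauliNoise.lean` transported to the additive picture, or any law on one CSS sector):

* `Decoder.logicalFailureProb D syn S μ = μ {e | ¬ D.Corrects syn S e}` — "Σ_E prob(E) · [recovery
  fails]" (Dennis et al. §4.3, eq. (ec_cond): the quantity whose vanishing defines the threshold;
  §5.2 `Prob_fail`), as an extended non-negative real (`PMF.toOuterMeasure`; on a finite error type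
  it is the finite sum `Σ_{e : ¬Corrects} μ e`, `logicalFailureProb_eq_sum`);
* `HasThreshold P pth` for a family `P : ℕ → ℝ → ℝ≥0∞` of failure probabilities (size index,
  physical rate): every `0 ≤ p < pth` has `P L p → 0` as `L → ∞` (§4.3 "fails with a probability
  that vanishes as the linear size `L` of the lattice increases to infinity"; the quantifier order
  is `∀ p < pth, lim_L = 0` — a threshold LOWER BOUND, the form in which every proved threshold is
  stated; the real-valued twin is `IsThresholdLowerBound` of `CodeCapacityNoise.lean`,
  `hasThreshold_iff_isThresholdLowerBound_toReal`).

Deliberately NOT here: any specific code, decoder or number; circuit-level noise; the VALIDATED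
column.

## References (read)

* [DennisEtAl2002] E. Dennis, A. Kitaev, A. Landahl, J. Preskill, *Topological quantum memory*,
  J. Math. Phys. 43 (2002) 4452–4505, arXiv:quant-ph/0110143, §4.3 (eq. (ec_cond); the threshold
  definition), §5.2 (`Prob_fail`).
-/

noncomputable section

namespace Literature.InformationTheory.QuantumCodes

open Filter Topology Finset
open scoped ENNReal

namespace Decoder

variable {Syn Err : Type*} [Add Err]

/-- **Logical failure probability** of the decoder `D` (syndrome map `syn`, stabilizer set `S`)
under the error law `μ`: the probability `μ {e | ¬ D.Corrects syn S e}` that recovery fails, i.e.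
that the net operation `D (syn e) + e` is NOT a stabilizer element ("`Σ_E prob(E) ·` [the recovery
chain differs from `E` by a non-trivial cycle]"). [cite: DennisEtAl2002, §4.3 eq. (ec_cond)] -/
def logicalFailureProb (D : Decoder Syn Err) (syn : Err → Syn) (S : Set Err) (μ : PMF Err) : ℝ≥0∞ :=
  μ.toOuterMeasure {e | ¬ D.Corrects syn S e}

/-- A failure probability is at most `1`. [cite: DennisEtAl2002, §4.3 eq. (ec_cond)] -/
theorem logicalFailureProb_le_one (D : Decoder Syn Err) (syn : Err → Syn) (S : Set Err)
    (μ : PMF Err) : D.logicalFailureProb syn S μ ≤ 1 := by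
  have h1 : μ.toOuterMeasure Set.univ = 1 :=
    (PMF.toOuterMeasure_apply_eq_one_iff μ Set.univ).2 (Set.subset_univ _)
  rw [logicalFailureProb, ← h1]
  exact PMF.toOuterMeasure_mono μ (Set.subset_univ _)

/-- On a finite error type the failure probability is the finite sum of the probabilities of the
failing errors, `Σ_{e : ¬Corrects} μ e`. [cite: DennisEtAl2002, §4.3 eq. (ec_cond)] -/
theorem logicalFailureProb_eq_sum [Fintype Err] (D : Decoder Syn Err) (syn : Err → Syn) (S : Set Err)
    (μ : PMF Err) [DecidablePred fun e => ¬ D.Corrects syn S e] :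
    D.logicalFailureProb syn S μ = ∑ e ∈ univ.filter (fun e => ¬ D.Corrects syn S e), μ e := by
  rw [logicalFailureProb, PMF.toOuterMeasure_apply_fintype, Finset.sum_filter]
  refine Finset.sum_congr rfl fun e _ => ?_
  by_cases h : ¬ D.Corrects syn S e
  · simp [h]
  · simp [h]

end Decoder

/-- **Threshold (lower bound) of a family of failure probabilities** `P L p` (size index `L`,
physical error rate `p`, values in `ℝ≥0∞` as produced by `Decoder.logicalFailureProb`): `pth` is a
threshold when for every rate `0 ≤ p < pth` the failure probability "vanishes as the linear size
`L` … increases to infinity". Use: `HasThreshold (fun L p => (D L).logicalFailureProb (syn L) (S L)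
(noise L p)) pth` for a code family with decoders `D L` and noise laws `noise L p`.
[cite: DennisEtAl2002, §4.3 (definition preceding eq. (ec_cond))] -/
def HasThreshold (P : ℕ → ℝ → ℝ≥0∞) (pth : ℝ) : Prop :=
  ∀ p : ℝ, 0 ≤ p → p < pth → Tendsto (fun L => P L p) atTop (𝓝 0)

/-- For families of genuine probabilities (values `≠ ∞`, e.g. `≤ 1`) the `ℝ≥0∞`-valued threshold
notion agrees with the real-valued `IsThresholdLowerBound` of `CodeCapacityNoise.lean` applied to
`toReal`. [cite: DennisEtAl2002, §4.3 (definition)] -/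
theorem hasThreshold_iff_isThresholdLowerBound_toReal {P : ℕ → ℝ → ℝ≥0∞}
    (hP : ∀ L p, P L p ≠ ∞) (pth : ℝ) :
    HasThreshold P pth ↔ IsThresholdLowerBound (fun L p => (P L p).toReal) pth := by
  refine forall₃_congr fun p _ _ => ?_
  change Tendsto (fun L => P L p) atTop (𝓝 0) ↔ Tendsto (fun L => (P L p).toReal) atTop (𝓝 0)
  constructor
  · intro h
    have := (ENNReal.tendsto_toReal ENNReal.zero_ne_top).comp h
    simpa [Function.comp_def] using this
  · intro h
    have h' : Tendsto (fun L => ENNReal.ofReal ((P L p).toReal)) atTop (𝓝 (ENNReal.ofReal 0)) :=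
      (ENNReal.continuous_ofReal.tendsto 0).comp h
    simp only [ENNReal.ofReal_zero] at h'
    refine h'.congr fun L => ?_
    exact ENNReal.ofReal_toReal (hP L p)

end Literature.InformationTheory.QuantumCodes

end
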